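import Mathlib
import HarnessLib
import Summits.RiemannHypothesis.RiemannHypothesis.Theorems.IntegerScrewParityDefect

/-!
# Route `IntegerScrew` — the Leibniz rule of the truncated multiplicative walk for ALL finite sets of primes:
# `ℒ_M(Π_{p∈S}φ_p) = Σ_{r∈S} (Π_{p∈S∖r}φ_p)·ℒ_Mφ_r`, i.e. `ℒ_Mφ_S = −λ_Sφ_S + Σ_{r∈S}φ_{S∖r}𝟙[r∤x]r_r` with
# `λ_S = Σ_{p∈S}λ_p` (CONTINUUM-LIMIT 23.18 (f): the exact input for every rung `S` of PIVOT-LAW 13.10 (iv))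

`walkGen_mul_of_jumps`: an abstract product rule — if along every jump of the walk (births `k → kn`, deaths
`k → k/d`, both prime powers since `Λ` kills the rest) at least one of `f, g` is unchanged, then
`ℒ_M(fg)(k) = g(k)·ℒ_Mf(k) + f(k)·ℒ_Mg(k)`.  `prod_parityFun_mul_eq_of_forall_ne` / `prod_parityFun_div_eq`:
a product of parity functions over primes `≠ r` is blind to jumps by powers of `r`.  `walkGen_parity_prod`: the
rule above, by induction on `S`; `walkGen_parity_prod_eq`: the explicit eigen-relation with defects.  RH-free.  Reference for the walk: M. Suzuki, J. Lond. Math. Soc. (2) 108 (2023)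
1448–1487 [Suzuki2023] (PROP. N4 of the rh-explicit A6-PIVOT programme).
-/

noncomputable section

set_option linter.dupNamespace false -- D-0017: `Summit.<S>.<S>.…` is the designed namespace

namespace Summit.RiemannHypothesis.RiemannHypothesis.Theorems.IntegerScrew

open Finset ArithmeticFunction

/-- **Abstract Leibniz rule.**  If along every birth `k → kn` and every death `k → k/d` with non-zero rate
(`Λ ≠ 0`) at least one of `f`, `g` does not move, then `ℒ_M(fg)(k) = g(k)ℒ_Mf(k) + f(k)ℒ_Mg(k)`. -/
theorem walkGen_mul_of_jumps {M : ℕ} (f g : ℕ → ℝ) (k : St M)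
    (hb : ∀ n : ℕ, Λ n ≠ 0 → f ((k : ℕ) * n) = f k ∨ g ((k : ℕ) * n) = g k)
    (hd : ∀ d : ℕ, d ∣ (k : ℕ) → Λ d ≠ 0 → f ((k : ℕ) / d) = f k ∨ g ((k : ℕ) / d) = g k) :
    ∑ j : St M, walkGen M k j * (f j * g j) =
      g k * ∑ j : St M, walkGen M k j * f j + f k * ∑ j : St M, walkGen M k j * g j := by
  rw [walkGen_sum_eq_arith M (fun j => f j * g j) k, walkGen_sum_eq_arith M f k, walkGen_sum_eq_arith M g k]
  -- the cross terms vanish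
  have hcb : ∀ n : ℕ, (Λ n : ℝ) * ((f ((k : ℕ) * n) - f k) * (g ((k : ℕ) * n) - g k)) = 0 := by
    intro n
    by_cases hΛ : Λ n = 0
    · rw [hΛ]; simp
    · rcases hb n hΛ with h | h <;> rw [h, sub_self] <;> simp
  have hcd : ∀ d ∈ (k : ℕ).divisors, (Λ d : ℝ) * ((f ((k : ℕ) / d) - f k) * (g ((k : ℕ) / d) - g k)) = 0 := by
    intro d hdm
    have hdk : d ∣ (k : ℕ) := (Nat.mem_divisors.1 hdm).1
    by_cases hΛ : Λ d = 0
    · rw [hΛ]; simp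
    · rcases hd d hdk hΛ with h | h <;> rw [h, sub_self] <;> simp
  have hbirth : ∀ n ∈ Finset.Icc 1 (M / k),
      (Λ n : ℝ) / ((n : ℝ) * Real.log M) * (f ((k : ℕ) * n) * g ((k : ℕ) * n) - f k * g k) =
      g k * ((Λ n : ℝ) / ((n : ℝ) * Real.log M) * (f ((k : ℕ) * n) - f k)) +
        f k * ((Λ n : ℝ) / ((n : ℝ) * Real.log M) * (g ((k : ℕ) * n) - g k)) := by
    intro n _
    have e : (Λ n : ℝ) / ((n : ℝ) * Real.log M) * (f ((k : ℕ) * n) * g ((k : ℕ) * n) - f k * g k) -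
      (g k * ((Λ n : ℝ) / ((n : ℝ) * Real.log M) * (f ((k : ℕ) * n) - f k)) +
        f k * ((Λ n : ℝ) / ((n : ℝ) * Real.log M) * (g ((k : ℕ) * n) - g k))) =
      (1 / ((n : ℝ) * Real.log M)) * ((Λ n : ℝ) * ((f ((k : ℕ) * n) - f k) * (g ((k : ℕ) * n) - g k))) := by
      rw [div_eq_mul_one_div]; ring
    rw [hcb n, mul_zero] at e
    linarith
  have hdeath : ∀ d ∈ (k : ℕ).divisors,
      (Λ d : ℝ) / Real.log M * (f ((k : ℕ) / d) * g ((k : ℕ) / d) - f k * g k) =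
      g k * ((Λ d : ℝ) / Real.log M * (f ((k : ℕ) / d) - f k)) +
        f k * ((Λ d : ℝ) / Real.log M * (g ((k : ℕ) / d) - g k)) := by
    intro d hdm
    have e : (Λ d : ℝ) / Real.log M * (f ((k : ℕ) / d) * g ((k : ℕ) / d) - f k * g k) -
      (g k * ((Λ d : ℝ) / Real.log M * (f ((k : ℕ) / d) - f k)) +
        f k * ((Λ d : ℝ) / Real.log M * (g ((k : ℕ) / d) - g k))) =
      (1 / Real.log M) * ((Λ d : ℝ) * ((f ((k : ℕ) / d) - f k) * (g ((k : ℕ) / d) - g k))) := by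
      rw [div_eq_mul_one_div]; ring
    rw [hcd d hdm, mul_zero] at e
    linarith
  rw [Finset.sum_congr rfl hbirth, Finset.sum_congr rfl hdeath, Finset.sum_add_distrib, Finset.sum_add_distrib,
    ← Finset.mul_sum, ← Finset.mul_sum, ← Finset.mul_sum, ← Finset.mul_sum]
  ring

/-- A product of parity functions over primes all `≠ r` does not see multiplication by a power of `r`. -/
theorem prod_parityFun_mul_eq_of_forall_ne (S : Finset ℕ) (hS : ∀ p ∈ S, p.Prime) {r : ℕ} (hr : r.Prime)
    (hrS : ∀ p ∈ S, p ≠ r) (k a : ℕ) :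
    ∏ p ∈ S, parityFun p (k * r ^ a) = ∏ p ∈ S, parityFun p k := by
  refine Finset.prod_congr rfl fun p hp => ?_
  -- p ∣ k r^a ↔ p ∣ k
  have hpp := hS p hp
  have hiff : p ∣ k * r ^ a ↔ p ∣ k := by
    constructor
    · intro h
      rcases (Nat.Prime.dvd_mul hpp).1 h with h1 | h1
      · exact h1
      · exact absurd ((Nat.prime_dvd_prime_iff_eq hpp hr).1 (hpp.dvd_of_dvd_pow h1)) (hrS p hp)
    · intro h; exact dvd_mul_of_dvd_left h _
  by_cases h : p ∣ k
  · rw [parityFun_of_dvd h, parityFun_of_dvd (hiff.2 h)]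
  · rw [parityFun_of_not_dvd h, parityFun_of_not_dvd (fun h' => h (hiff.1 h'))]

/-- A product of parity functions over primes not dividing `d ∣ k` does not see the division `k → k/d`. -/
theorem prod_parityFun_div_eq (S : Finset ℕ) (hS : ∀ p ∈ S, p.Prime) {d k : ℕ} (hdk : d ∣ k)
    (hSd : ∀ p ∈ S, ¬ p ∣ d) :
    ∏ p ∈ S, parityFun p (k / d) = ∏ p ∈ S, parityFun p k := by
  refine Finset.prod_congr rfl fun p hp => ?_
  have hpp := hS p hp
  have hk : k = d * (k / d) := (Nat.mul_div_cancel' hdk).symm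
  have hiff : p ∣ k / d ↔ p ∣ k := by
    constructor
    · intro h; rw [hk]; exact dvd_mul_of_dvd_right h _
    · intro h
      rw [hk] at h
      rcases (Nat.Prime.dvd_mul hpp).1 h with h1 | h1
      · exact absurd h1 (hSd p hp)
      · exact h1
  by_cases h : p ∣ k
  · rw [parityFun_of_dvd h, parityFun_of_dvd (hiff.2 h)]
  · rw [parityFun_of_not_dvd h, parityFun_of_not_dvd (fun h' => h (hiff.1 h'))]

/-- **Leibniz rule for every finite set of primes**: `ℒ_M(Π_{p∈S}φ_p)(k) = Σ_{r∈S} (Π_{p∈S∖r}φ_p(k))·ℒ_Mφ_r(k)`.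
With `IntegerScrewParityDefect.walkGen_parity` (`ℒ_Mφ_r = −λ_rφ_r + 𝟙[r∤x]r_r`) this is the exact eigen-relation
`ℒ_Mφ_S = −λ_Sφ_S + Σ_{r∈S}φ_{S∖r}𝟙[r∤x]r_r`, `λ_S = Σ_{r∈S}λ_r` (CONTINUUM-LIMIT 23.18 (f)). -/
theorem walkGen_parity_prod {M : ℕ} (S : Finset ℕ) (hS : ∀ p ∈ S, p.Prime) (k : St M) :
    ∑ j : St M, walkGen M k j * ∏ p ∈ S, parityFun p j =
      ∑ r ∈ S, (∏ p ∈ S.erase r, parityFun p k) * ∑ j : St M, walkGen M k j * parityFun r j := by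
  classical
  induction S using Finset.induction_on with
  | empty =>
    simp only [Finset.prod_empty, mul_one, Finset.sum_empty]
    -- rows sum to zero: Σ_j walkGen(k,j)·1 = Σ_j rate·(1 − 1) = 0
    have h := walkGen_sum_eq M (fun _ => (1 : ℝ)) k
    simp only [mul_one, sub_self, mul_zero, Finset.sum_const_zero] at h
    exact h
  | insert r S' hr ih =>
    have hS' : ∀ p ∈ S', p.Prime := fun p hp => hS p (Finset.mem_insert_of_mem hp)
    have hrp : r.Prime := hS r (Finset.mem_insert_self r S')
    have hne : ∀ p ∈ S', p ≠ r := fun p hp h => hr (h ▸ hp)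
    -- Π_{insert r S'} = φ_r · Π_{S'}
    have hprod : ∀ j : ℕ, ∏ p ∈ insert r S', parityFun p j = (∏ p ∈ S', parityFun p j) * parityFun r j := by
      intro j; rw [Finset.prod_insert hr, mul_comm]
    simp only [hprod]
    -- abstract Leibniz with f = Π_{S'} φ, g = φ_r
    have hL := walkGen_mul_of_jumps (M := M) (fun j => ∏ p ∈ S', parityFun p j) (fun j => parityFun r j) k ?_ ?_
    rotate_left
    · intro n hΛ
      obtain ⟨t, a, ht, _, rfl⟩ := vonMangoldt_ne_zero_iff.1 hΛ
      have htp : t.Prime := ht.nat_prime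
      by_cases htr : t = r
      · left; subst htr
        exact prod_parityFun_mul_eq_of_forall_ne S' hS' htp hne k a
      · right
        -- φ_r blind to powers of t ≠ r
        have := prod_parityFun_mul_eq_of_forall_ne {r} (fun p hp => by rw [Finset.mem_singleton.1 hp]; exact hrp)
          htp (fun p hp => by rw [Finset.mem_singleton.1 hp]; exact fun h => htr h.symm) k a
        simpa using this
    · intro d hdk hΛ
      obtain ⟨t, a, ht, _, rfl⟩ := vonMangoldt_ne_zero_iff.1 hΛ
      have htp : t.Prime := ht.nat_prime
      by_cases htr : t = r
      · left; subst htr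
        refine prod_parityFun_div_eq S' hS' hdk fun p hp h => ?_
        exact hne p hp ((Nat.prime_dvd_prime_iff_eq (hS' p hp) htp).1 ((hS' p hp).dvd_of_dvd_pow h))
      · right
        have hrd : ¬ r ∣ t ^ a := fun h => htr ((Nat.prime_dvd_prime_iff_eq hrp htp).1 (hrp.dvd_of_dvd_pow h)).symm
        have := prod_parityFun_div_eq {r} (fun p hp => by rw [Finset.mem_singleton.1 hp]; exact hrp) hdk
          (fun p hp => by rw [Finset.mem_singleton.1 hp]; exact hrd)
        simpa using this
    rw [hL, ih hS', Finset.sum_insert hr, Finset.erase_insert hr]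
    -- bookkeeping: the r' ∈ S' terms carry the extra factor φ_r(k)
    have hrest : ∀ r' ∈ S', ∏ p ∈ (insert r S').erase r', parityFun p (k : ℕ) =
        parityFun r k * ∏ p ∈ S'.erase r', parityFun p k := by
      intro r' hr'
      rw [Finset.erase_insert_of_ne (Ne.symm (hne r' hr')),
        Finset.prod_insert (fun h => hr (Finset.mem_of_mem_erase h))]
    have hR : ∑ r' ∈ S', (∏ p ∈ (insert r S').erase r', parityFun p (k : ℕ)) *
        ∑ j : St M, walkGen M k j * parityFun r' j =
        parityFun r k * ∑ r' ∈ S', (∏ p ∈ S'.erase r', parityFun p (k : ℕ)) *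
          ∑ j : St M, walkGen M k j * parityFun r' j := by
      rw [Finset.mul_sum]
      refine Finset.sum_congr rfl fun r' hr' => ?_
      rw [hrest r' hr']
      ring
    rw [hR]
    ring

/-- **Exact eigen-relation for `φ_S = Π_{p∈S}φ_p`** (every finite set `S` of primes):
`ℒ_Mφ_S(k) = −(λ_S/log M)·φ_S(k) + (1/log M)·Σ_{r∈S} φ_{S∖r}(k)·D_r(k)`, `λ_S = Σ_{r∈S} r log r/(r−1)`,
`D_r(k) = 𝟙[r ∤ k]·(log r/(r−1) − Σ_{n ≤ M/k, r|n}Λ(n)/n)` — CONTINUUM-LIMIT 23.18 (f): in the untruncated walk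
`φ_S` is an exact eigenfunction with eigenvalue `−λ_S` (additivity over the primes of `S`); the wall enters only
through the blocked-birth defects `D_r`, each supported on `r ∤ k` near the top (`M/k < r^a`). -/
theorem walkGen_parity_prod_eq {M : ℕ} (S : Finset ℕ) (hS : ∀ p ∈ S, p.Prime) (k : St M) :
    ∑ j : St M, walkGen M k j * ∏ p ∈ S, parityFun p j =
      -((∑ r ∈ S, (r : ℝ) * Real.log r / ((r : ℝ) - 1)) / Real.log M) * ∏ p ∈ S, parityFun p k +
        (1 / Real.log M) * ∑ r ∈ S, (∏ p ∈ S.erase r, parityFun p k) *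
          (if r ∣ (k : ℕ) then 0 else
            (Real.log r / ((r : ℝ) - 1) - ∑ n ∈ (Icc 1 (M / k)).filter (fun n => r ∣ n), Λ n / n)) := by
  classical
  rw [walkGen_parity_prod S hS k]
  have e : ∀ r ∈ S, (∏ p ∈ S.erase r, parityFun p (k : ℕ)) * ∑ j : St M, walkGen M k j * parityFun r j =
      -(1 / Real.log M) * ((r : ℝ) * Real.log r / ((r : ℝ) - 1) * ∏ p ∈ S, parityFun p (k : ℕ)) +
        (1 / Real.log M) * ((∏ p ∈ S.erase r, parityFun p (k : ℕ)) *
          (if r ∣ (k : ℕ) then 0 else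
            (Real.log r / ((r : ℝ) - 1) - ∑ n ∈ (Icc 1 (M / k)).filter (fun n => r ∣ n), Λ n / n))) := by
    intro r hr
    rw [walkGen_parity (hS r hr) k, ← Finset.prod_erase_mul S (fun p => parityFun p (k : ℕ)) hr]
    ring
  rw [Finset.sum_congr rfl e, Finset.sum_add_distrib, ← Finset.mul_sum, ← Finset.mul_sum, ← Finset.sum_mul]
  ring

end Summit.RiemannHypothesis.RiemannHypothesis.Theorems.IntegerScrew

end
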